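import Mathlib.Geometry.Manifold.Instances.Sphere
import Mathlib.Geometry.Manifold.Diffeomorph
import Mathlib.Topology.Homotopy.Equiv
import Mathlib.AlgebraicTopology.FundamentalGroupoid.SimplyConnected
import Mathlib.Analysis.SpecialFunctions.Complex.Circle
import Literature.Topology.FourManifolds.Trisections
import Literature.Topology.FourManifolds.ClosedBall
import Literature.Topology.FourManifolds.WeaklyReducibleTrisections
import Literature.Topology.FourManifolds.WeaklyReducibleGenusThreeTrisections
import Literature.Topology.FourManifolds.ReducibleTrisectionSplitting
import Literature.Topology.FourManifolds.HomotopySphereSummands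
import Literature.Topology.FourManifolds.HomotopySphereSummandsHolds
import Literature.Topology.FourManifolds.ConnectedSumSummands
import Literature.Topology.FourManifolds.ConnectedSumSphereIdentity
import Literature.Topology.FourManifolds.HomotopyS4CompactProofs
import Literature.Topology.FourManifolds.HomotopyS4OrientableProofs
import Literature.Topology.FourManifolds.SphereSimplyConnected
import Literature.Topology.FourManifolds.TrisectionEulerProofs
import Literature.AlgebraicTopology.FundamentalGroup.CircleValuedLift
import Literature.Topology.FourManifolds.ReducibleTrisectionNotSimplyConnected
import Literature.Barriers.SmoothPoincare4.LowGenusTrisectionsStandard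
import Literature.Barriers.SmoothPoincare4.LowGenusTrisectionsStandardProofs
import HarnessLib

/-!
# Barrier (SmoothPoincare4): weakly reducible genus-three trisections carry no exotic 4-sphere (Aranda–Zupan 2025)

Barrier catalogue `Literature/Barriers/SmoothPoincare4/` (D-0021), next entry after
`LowGenusTrisectionsStandard.lean` for the technique class **"exhibit an exotic 4-sphere by a
low-genus trisection (diagram)"**: at genus `3`, the first genus left open by Meier–Zupan /
Meier–Schirmer–Zupan, every WEAKLY REDUCIBLE trisection is again standard.

## What is printed

Aranda–Zupan, *Manifolds with weakly reducible genus-three trisections are standard*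
(arXiv:2503.04607, 2025), read at page level (`lit read arxiv:2503.04607`, 2026-08-17):

* p. 2, Theorem 1.3, verbatim: "Suppose `X` admits a weakly reducible genus-three trisection
  `T`. Then either `T` is reducible, or `T` contains a five-chain. In particular, `X` is
  diffeomorphic to a spun lens space `S_p` or its sibling `S'_p`, `S⁴`, or a connected sum of
  copies of `±ℂP²`, `S¹ × S³`, and `S² × S²`."
* p. 6 (§2), the definition, verbatim: "We say that `T` is weakly reducible if there exist
  non-separating curves `c` and `c'` in `Σ` such that `c` is a compressing curve for `H_α` and
  `c'` is a compressing curve for both `H_β` and `H_γ`." (p. 2: "disjoint non-separating curves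
  `c` and `c'`"; Remark 2.5 explains why non-separating is required.)
* p. 1, Theorem 1.1 [MZ17b] (genus two) and Conjecture 1.2 [Mei18] (genus three: `S_p`, `S'_p`,
  `S⁴` or such connected sums) — Theorem 1.3 is Meier's conjecture for weakly reducible `T`;
  p. 27, Question 8.3: "Do there exist genus-three trisections that are not weakly irreducible?"
  [sic] — candidate strongly irreducible `(3;1)`-trisections are named there, so the weakly
  reducible hypothesis is NOT known to be automatic.

## How it is rendered here (relative to the tree's notions, D-0014)

Exactly in the style of `mz_genus_le_two_homotopySphere_gk` (sibling file): trisections are the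
tree's corrected predicate `Literature.Topology.FourManifolds.IsGKTrisection X g k S` (genus `g = 3`,
any `k : Fin 3 → ℕ`), the central surface is `F = ⋂ l, S l`, the three handlebodies are
`H p = ⋂ (l ≠ p), S l`, a CURVE is a smoothly embedded circle in `F`, "compressing curve for
`H p`" is "bounds a properly embedded smooth disc in `H p` meeting `F` exactly in the curve",
"non-separating" is `IsConnected (F \ c)` — the SAME inline clauses as the route item this fact
grounds, `Summit.SmoothPoincare4.SmoothPoincare4.Theses.WeakReductionDescent.GenusThreeBase`
(stmt-SmoothPoincare4-17836), so that the item is this fact instantiated on a `HomotopySphere 4`.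
The printed CONCLUSION (a finite diffeomorphism list) is weakened to its homotopy-sphere
corollary "`X ≃ₕ S⁴ ⇒ X ≅ S⁴`": in the list, `S_p`, `S'_p` have `π₁ = ℤ/p` (`p ≥ 2`), an
`S¹ × S³` summand gives `π₁ ≠ 1`, and a `±ℂP²` or `S² × S²` summand gives `b₂ > 0`, so the only
homotopy 4-sphere listed is `S⁴` (the full list would need spun-lens-space and connected-sum
vocabulary matched to trisections, as for the sibling facts). Users take
`(h : az2025_weaklyReducible_genusThree_homotopySphere_gk)`.

* `az2025_weaklyReducible_genusThree_homotopySphere_gk` — the named fact.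
* `az2025_weaklyReducible_genusThree_homotopySphere_gk_of_smoothPoincare` — sanity link, PROVED:
  the fact is implied by the smooth 4-dimensional Poincaré conjecture (so it is summit-safe as a
  route input).
* `az2025_weaklyReducible_genusThree_homotopySphere_gk_iff_topic`,
  `az2025_weaklyReducible_genusThree_homotopySphere_gk_iff_routeShape` — dedup record, PROVED: the
  tree carries THREE vendorings of the same corollary of AZ25 Thm 1.3, and they coincide — this
  fact is DEFINITIONALLY the topic fact
  `Literature.Topology.FourManifolds.arandaZupan_genus_three_weaklyReducible_homotopySphere_gk`
  (`WeaklyReducibleTrisections.lean`, stated through `Trisection.IsWeaklyReducible`, whose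
  unfolding `Trisection.isWeaklyReducible_iff` is `Iff.rfl`), at every universe, and at universe
  `0` it is equivalent to the route-shaped fact
  `Literature.Topology.FourManifolds.arandaZupan_weaklyReducible_genusThree_homotopySphere`
  (`WeaklyReducibleGenusThreeTrisections.lean`, bare `M ≃ₕ S⁴` binders: compactness,
  connectedness and orientability of a homotopy 4-sphere are PROVED tree theorems). Discharging
  any one of the three discharges all three.
* `Trisection.isWeaklyReducible_comp_perm` (with `centralSurfaceSet_comp_perm`,
  `spineHandlebody_comp_perm`, `isCurve_comp_perm`, `boundsDisc_comp_perm`,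
  `isNonSeparating_comp_perm`) — PROVED: the Aranda–Zupan vocabulary is invariant under
  relabelling the sectors (`IsGKTrisection.comp_perm`).
* `az2025_weaklyReducible_genusThree_homotopySphere_gk_of_zero`,
  `az2025_weaklyReducible_genusThree_homotopySphere_gk_of_msz_of_balanced`,
  `az2025_weaklyReducible_genusThree_homotopySphere_gk.balanced_zero` — reduction to the core
  case, PROVED: the fact follows from its instance with the labels fixed (`c` compressing in
  `H_0`, `c'` in `H_1`, `H_2`), and, GIVEN the sibling fact `msz_homotopySphere_gk`, it is
  equivalent to that instance for BALANCED `(3; 1,1,1)`-trisections — by the PROVED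
  Euler-characteristic theorem
  `Literature.Topology.FourManifolds.gkTrisection_genus_eq_sum_of_homotopyEquiv_sphere_holds` a
  genus-`3` trisection of a homotopy 4-sphere has `k₀ + k₁ + k₂ = 3`, and every unbalanced such
  type has some `kᵢ ≥ 2 = g - 1` (Meier–Schirmer–Zupan's range).
* `not_simplyConnectedSpace_circle_prod_sphereThree` (PROVED: `π₁(S¹ × S³) ≠ 1`),
  `nonempty_diffeomorph_sphere_of_isReducible_genusThree_of_facts`,
  `az2025_weaklyReducible_genusThree_homotopySphere_gk_of_facts_of_irreducible` — the REDUCIBLE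
  branch of Aranda–Zupan's proof (§6, p. 20, first paragraph) for homotopy spheres, PROVED from
  the tree's named facts: GIVEN the two splitting facts for reducible trisections
  (`ReducibleTrisectionSplitting.lean`), Kosinski's "a summand of a homotopy 4-sphere is a
  homotopy 4-sphere" (`HomotopySphereSummands.lean`) and the genus-`≤ 2` fact, a homotopy
  4-sphere with a reducible genus-`3` trisection is `S⁴` (non-separating reducing curves are
  excluded by `π₁`, separating ones give `S⁴ # S⁴ ≅ S⁴` by the PROVED
  `connectedSum_sphere_sphere_holds`); consequently, GIVEN `msz_homotopySphere_gk`, the splitting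
  facts and Kosinski's, the fact is REDUCED to balanced `(3; 1,1,1)`-trisections with fixed labels
  that are weakly reducible and IRREDUCIBLE — Aranda–Zupan's five-chain case, the only input
  without a counterpart in the tree.  Kosinski's fact is meanwhile DISCHARGED at every universe
  (`Literature.Topology.FourManifolds.nonempty_homotopyEquiv_sphere_four_left_of_isConnectedSum_holds`,
  `HomotopySphereSummandsHolds.lean`), whence the unconditional-in-Kosinski forms
  `nonempty_diffeomorph_sphere_of_isReducible_genusThree_of_splitting` and
  `az2025_weaklyReducible_genusThree_homotopySphere_gk_of_msz_of_splitting_of_irreducible`: the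
  fact now rests on exactly THREE named facts of the tree (`msz_homotopySphere_gk` and the two
  splitting facts) plus Aranda–Zupan's irreducible case — and, the non-separating case having
  since become the theorem `Trisection.not_simplyConnectedSpace_of_reducing_nonseparating`, on
  `msz_homotopySphere_gk`, the SEPARATING splitting fact and the irreducible case only
  (`az2025_weaklyReducible_genusThree_homotopySphere_gk_of_msz_of_separating_of_irreducible`, last
  subsection of "ReducibleBranch"; see "Proof status", (4)).

## Proof status (provefact seat, 2026-08-17)

Not discharged: triaged XL. The printed proof (AZ25 §§3–6, pp. 7–24) is diagrammatic —
Prop. 3.9 (normal form of a weakly reducible genus-three diagram, via Haken's lemma [Hak68],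
untelescoping and thin position [CG87, ST94, SSS16], Cho–Koda's genus-two lemmas [CK14, CK15],
Waldhausen's theorem [Wal68]), Heegaard triples (§4: [NO85] wave property, [MZ17b] Prop. 3.1,
Thm. 4.8), five-chain surgery (§5, Thm. 5.1, Prop. 5.5), and the nine-case assembly (§6) on top of
Meier–Zupan's genus-two classification [MZ17b] — and needs, before anything, the correspondence
between trisection DIAGRAMS and the tree's `IsGKTrisection` (Gay–Kirby + Laudenbach–Poénaru +
Waldhausen). Of these inputs the tree has only Waldhausen's theorem as an UNPROVED fact
(`Literature.Topology.FourManifolds.waldhausen_heegaardSplitting_sumS1S2_unique`) and the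
genus-`≤ 2` classifications as UNPROVED homotopy-sphere corollaries
(`mz_genus_le_two_homotopySphere_gk`, `msz_homotopySphere_gk`); Heegaard/trisection diagrams,
compression bodies, handle slides, thin position, waves, five-chains and spun lens spaces have no
declarations at all.  What IS proved here is the reduction of the fact to its core: GIVEN
`msz_homotopySphere_gk`, it remains to treat balanced `(3; 1,1,1)`-trisections of homotopy
4-spheres with a weak reduction `c ⊂ H_0`, `c' ⊂ H_1, H_2` (section "Reduction" at the end of the
file) — Aranda–Zupan's case `(k₁, k₂) = (1, 1)` (§6, p. 24: reducible, or a five-chain and then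
`X ∈ {S_p, S'_p}` by Prop. 5.5) — and, GIVEN moreover the two splitting facts of
`ReducibleTrisectionSplitting.lean` and Kosinski's summand fact (`HomotopySphereSummands.lean`),
only the IRREDUCIBLE ones among them (section "ReducibleBranch": the reducible branch is proved
from those facts; the irreducible branch is Aranda–Zupan's five-chain case, Prop. 3.9 + §§4–6,
absent from the tree together with its 3-manifold inputs).

*Universe bookkeeping (sibling `WeaklyReducibleGenusThreeStandardProofs.lean`, all PROVED).*
The fact is universe polymorphic (`X : Type u`, and `IsGKTrisection` carries its model pieces in
the universe of `X`), while any proof ends in `Type 0` models.  The sibling file shows that the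
debt node is universe-free: the fact at any one universe gives it at every universe
(`az2025_weaklyReducible_genusThree_homotopySphere_gk_of_univ`, `…_univ_iff` — a closed smooth
4-manifold is small, its copy `Shrink.{v} X` carries the transported smooth structure,
`Literature/Topology/FourManifolds/ManifoldShrink.lean`, and the trisection WITH ITS PIECES, the
weak reduction and the homotopy equivalence move along `Shrink X ≅ X`,
`TrisectionShrink.lean`, `WeaklyReducibleTrisectionsNaturality.lean`); hence this fact, the topic
fact and the route-shaped `Type 0` fact of the dedup record below are equivalent at ALL universes
(`…_iff_topic_univ`, `…_iff_routeShape_univ`; before, `…_iff_routeShape` gave `u = 0` only), the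
sibling facts `msz_homotopySphere_gk`, `mz_genus_le_two_homotopySphere_gk` and the two splitting
facts are universe-free as well (`msz_homotopySphere_gk_univ_iff`, …,
`Literature/Topology/FourManifolds/ReducibleTrisectionSplittingUniv.lean`), and so is the
irreducible core `hirr` (`az2025_irreducibleCore_of_univ`), so that the fact at every universe
follows from `Type 0` data alone
(`az2025_weaklyReducible_genusThree_homotopySphere_gk_of_facts_zero_of_irreducible_zero`).

## Review of the statement (split-review seat, 2026-08-17): confirmed as printed; why no `_holds`

Re-read against the materialised pages of arXiv:2503.04607v1.  (a) *Hypotheses.* p. 2: "we say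
that `T` is weakly reducible if there are disjoint non-separating curves `c` and `c′` such that
`c` bounds a disk in one of the three handlebodies, and `c′` bounds a disk in the other two" —
exactly the inline clauses (`Disjoint`, `IsConnected (F \ c)`, `BoundsDisc (H p) c`,
`∀ q ≠ p, BoundsDisc (H q) c′`); the §2 sentence on p. 6 omits "disjoint" but the caption of
Fig. 3 (p. 6) and p. 2 carry it (without it every `(3; 1,1,1)`-trisection would qualify: the
genus-`3` splitting `H_β ∪ H_γ` of `∂X₃ = S¹ × S²` is standard by Waldhausen's theorem (p. 4), so
it has a common non-separating meridian, and `H_α` has non-separating meridians).  Any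
`k : Fin 3 → ℕ` is allowed, as in Thm. 1.3 (p. 6, Prop. 2.6 [MSZ16] disposes of `kᵢ ≥ g − 1`).
(b) *Conclusion.* The weakening to "`X ≃ₕ S⁴ ⇒ X ≅ S⁴`" is the printed list ∩ homotopy spheres:
p. 7, Lemma 2.7 and its proof, "`π₁(X) = ℤ/pℤ`" for `X = S_p, S′_p`, and "When `p = 1`, we have
that `S₁` and `S′₁` are diffeomorphic to `S⁴`"; a `±ℂP²`, `S² × S²` summand has `b₂ > 0`, an
`S¹ × S³` summand `π₁ ≠ 1`.  The printed simply-connected form is Cor. 1.5 (p. 2): a weakly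
reducible `T` has the dependent triple `(c, c′, parallel copy of c′)`, so a simply connected `X`
is "`S⁴` or a connected sum of copies of `±ℂP²`, and `S² × S²`".  (c) *Status of the source.* A
complete proof is printed (§6, pp. 20–24, on Prop. 3.9, Thm. 4.8, Lemma 5.4, Prop. 5.5); no
journal version was located (Crossref, 2026-08-17).  So the fact is neither mis-stated nor an
open problem, and it is not a decomposition child of anything: it is this catalogue entry's one
named fact (D-0021), vendored for the route item `GenusThreeBase` (now
`stmt-SmoothPoincare4-17910`, closed modulo this fact by
`Summit.SmoothPoincare4.SmoothPoincare4.Theorems.genusThreeBase_iff_az2025`).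

*Why it is not discharged inline (XL = a theory), stated as dependencies on EXISTING tree facts.*
(1) Like `msz_homotopySphere_gk` (see `LowGenusTrisectionsStandardProofs.lean`, "Why
`msz_homotopySphere_gk` is not discharged"), the fact CONTAINS Cerf's `Γ₄ = 0`: a twisted sphere
`D⁴ ∪_φ D⁴ ≃ₕ S⁴` carries the bevelled genus-`0` trisection, and its three-fold stabilisation
(one stabilisation of each type) is a `(3; 1,1,1)`-trisection that is weakly reducible — `c′`
the common `β = γ` curve of the genus-one summand of type `k₃ = 1`, `c` the `α`-curve of either
other summand (disjoint, both non-separating meridians) — so, modulo that elementary construction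
over `IsGKTrisection` (not in the tree), a discharge yields
`Literature.Topology.FourManifolds.cerf_twistedSphere_four` (reduced in tree to the leaf
`Literature.Topology.FourManifolds.cerf_pi0DiffDisc_relBoundary_three`), unproved.
(2) The printed proof rests on: [MSZ16] (p. 6 Prop. 2.6 for the unbalanced types; tree slice
`msz_homotopySphere_gk`, unproved, itself XL), [MZ17b] (p. 20 reducible case and p. 24, the
`(2; k₁, k₂, 2)`-trisection after five-chain surgery is standard; tree slice
`mz_genus_le_two_homotopySphere_gk`, a consequence of `msz_homotopySphere_gk`), Waldhausen [Wal68]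
(p. 4; `Literature.Topology.FourManifolds.waldhausen_heegaardSplitting_sumS1S2_unique`, unproved),
Laudenbach–Poénaru [LP72] (p. 7; it is what makes "a trisection `T` determined up to
diffeomorphism by its spine", p. 2, and "by a trisection diagram", p. 5;
`Literature.Topology.FourManifolds.exists_diffeomorph_comp_incl_eq`, unproved), and on inputs
with no declaration in the tree: Haken's lemma [Hak68] (Lemma 2.2),
untelescoping / thin position [CG87, ST94, SSS16] (Prop. 2.4), Cho–Koda [CK14, CK15]
(Lemmas 3.1–3.3), the wave property [NO85] (Thm. 4.4) and [HOT80], loop surgery and siblings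
[Glu62, Pao77] (§2, p. 7).  In terms of the proved reduction of this file
(`az2025_weaklyReducible_genusThree_homotopySphere_gk_of_facts_of_irreducible`): the unbalanced
types and the reducible branch are discharged modulo `msz_homotopySphere_gk` (hypothesis `hMSZ`)
and the splitting / summand facts, while the remaining hypothesis `hirr` (balanced, weakly
reducible, irreducible) is Prop. 3.9 + §§4–6, whose inputs with a declaration in the tree are
Waldhausen's theorem ("standard diagrams come up in a number of places in our arguments",
p. 4), Laudenbach–Poénaru and Cerf — and whose genus-two input on p. 24 (the
`(2; 1,1,2)`-trisection `T′` is standard, `X′ ≅ S¹ × S³`) is the general [MZ17b]/[MSZ16]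
classification, NOT the homotopy-sphere slices `mz_…`/`msz_…` of the tree.  Both review seats
(2026-08-17) therefore left the entry waiting on
`Literature.Topology.FourManifolds.waldhausen_heegaardSplitting_sumS1S2_unique`.
(3) Dedup pointer: of the three equivalent vendorings (`_iff_topic`, `_iff_routeShape`
below), only this one has users outside docstrings (the two `Theorems/WeakReductionDescent…`
files on the Summits side); the two topic copies can be retired by a dedup unit.
(4) *Where the fact stands (provefact seat, 2026-08-17, later the same day; every companion is
PROVED, none introduces a named fact).*  The `π₁`-shadow of the NON-SEPARATING reducible case is
now the tree's theorem
`Literature.Topology.FourManifolds.Trisection.not_simplyConnectedSpace_of_reducing_nonseparating`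
(`ReducibleTrisectionNotSimplyConnected.lean`), so the non-separating splitting record of
`ReducibleTrisectionSplitting.lean` is no longer an input (last subsection of "ReducibleBranch"
below), and Kosinski's summand fact is discharged (above).  Companions, in order:
`WeaklyReducibleGenusThreeStandardProofs.lean` (universe bookkeeping; the reducible branch from
the SEPARATING splitting fact), `LowGenusTrisectionsStandardOfClassification.lean`
(`msz_…`/`mz_…` as corollaries of the Meier–Schirmer–Zupan classification
`Literature.Topology.FourManifolds.msz_trisection_classification_gk`),
`WeaklyReducibleGenusThreeStandardOfLoopSurgery.lean` (the irreducible core from the loop-surgery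
fact `Literature.Topology.FourManifolds.msz_loopSurgery_homotopySphere_gk` and the FIVE-CHAIN
SURGERY STEP, inline), `WeaklyReducibleGenusThreeStandardOfSeparatingSplitting.lean` (the shadow
fed into every assembly).  Net: at every universe the fact follows from THREE existing named
facts of the tree — `msz_trisection_classification_gk` (or its corollary `msz_homotopySphere_gk`),
`Literature.Topology.FourManifolds.Trisection.isConnectedSum_of_reducing_separating`,
`msz_loopSurgery_homotopySphere_gk`, all taken at `Type 0` — and ONE inline hypothesis with no
tree name, the five-chain surgery step (Thm. 1.3 first part + Lemma 5.4 + Prop. 5.5: an irreducible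
weakly reducible balanced `(3; 1)`-trisected `X : Type` is a circle surgery on a loop of some
`X′ : Type` carrying a genus-`2` GK-trisection in the MSZ range;
`az2025_weaklyReducible_genusThree_homotopySphere_gk_of_classification_of_sep_of_loopSurgery_of_fiveChainSurgery'`),
equivalently from `msz_homotopySphere_gk`, the separating splitting fact and the irreducible core
`hirr` (`az2025_weaklyReducible_genusThree_homotopySphere_gk_of_msz_of_separating_of_irreducible`
below).  The five-chain step is the diagrammatic heart of the paper (Prop. 3.9, §4, §5) and rests
on Waldhausen's theorem
(`Literature.Topology.FourManifolds.waldhausen_heegaardSplitting_sumS1S2_unique`, unproved) and on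
a correspondence between cut systems / trisection diagrams and `IsGKTrisection` that the tree
does not have.
[cite: ArandaZupan2025, Thm. 1.3 and Cor. 1.5 (p. 2), §2 (pp. 4–7: Lemma 2.2, Prop. 2.4, Prop. 2.6, Lemma 2.7), §6 (pp. 20–24)]
-/

noncomputable section

open scoped Manifold ContDiff
open Set ContinuousMap

namespace Literature.Barriers.SmoothPoincare4

universe u

/-- Local notation for the model space `ℝⁿ = EuclideanSpace ℝ (Fin n)`. -/
local notation "𝔼 " n:arg => EuclideanSpace ℝ (Fin n)

/-- Local notation for the unit sphere `Sⁿ ⊂ ℝⁿ⁺¹`. -/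
local notation "𝕊 " n:arg => (Metric.sphere (0 : EuclideanSpace ℝ (Fin (n + 1))) 1)

/-- **Aranda–Zupan 2025, Theorem 1.3, homotopy-sphere corollary (named fact).** Let `X` be a
closed, connected, oriented smooth 4-manifold with a `(3; k₀, k₁, k₂)`-trisection
(`Literature.Topology.FourManifolds.IsGKTrisection X 3 k S`) that is WEAKLY REDUCIBLE: there are
disjoint non-separating smoothly embedded circles `c`, `c'` on the central surface
`F = S 0 ∩ S 1 ∩ S 2`, with `c` bounding a properly embedded smooth disc in one handlebody
`⋂ (l ≠ p), S l` and `c'` bounding such discs in the other two (AZ25 §2, p. 6; p. 2 "disjoint").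
If `X ≃ₕ S⁴` then `X ≅ S⁴` — since by Thm 1.3 "`X` is diffeomorphic to a spun lens space `S_p` or
its sibling `S'_p`, `S⁴`, or a connected sum of copies of `±ℂP²`, `S¹ × S³`, and `S² × S²`", and
`S⁴` is the only homotopy 4-sphere in that list. Conclusion weakened to "`≅ S⁴`" (as for
`mz_genus_le_two_homotopySphere_gk`). Grounds
`Summit.SmoothPoincare4.SmoothPoincare4.Theses.WeakReductionDescent.GenusThreeBase`
(stmt-SmoothPoincare4-17836): that item is this fact on a `HomotopySphere 4` (same inline
clauses). Users take `(h : az2025_weaklyReducible_genusThree_homotopySphere_gk)`.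
[cite: ArandaZupan2025, Thm. 1.3 (p. 2) and §2 (definition of weakly reducible, p. 6)] -/
def az2025_weaklyReducible_genusThree_homotopySphere_gk : Prop :=
  ∀ (X : Type u) [TopologicalSpace X] [T2Space X] [SecondCountableTopology X]
    [ChartedSpace (𝔼 4) X] [IsManifold (𝓡 4) ∞ X] [CompactSpace X] [ConnectedSpace X]
    (_ : Literature.Topology.FourManifolds.SmoothOrientation (𝓡 4) X) (k : Fin 3 → ℕ)
    (S : Fin 3 → Set X),
    Literature.Topology.FourManifolds.IsGKTrisection X 3 k S →
    (let F : Set X := ⋂ l, S l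
     let H : Fin 3 → Set X := fun p => ⋂ (l : Fin 3) (_ : l ≠ p), S l
     let IsCurve : Set X → Prop := fun c => c ⊆ F ∧
       ∃ γ : (𝕊 1) → X, Manifold.IsSmoothEmbedding (𝓡 1) (𝓡 4) ((⊤ : ℕ∞) : WithTop ℕ∞) γ ∧
         Set.range γ = c
     let BoundsDisc : Set X → Set X → Prop := fun A c =>
       ∃ d : (Metric.closedBall (0 : EuclideanSpace ℝ (Fin 2)) 1) → X,
         Manifold.IsSmoothEmbedding (𝓡∂ 2) (𝓡 4) ((⊤ : ℕ∞) : WithTop ℕ∞) d ∧ Set.range d ⊆ A ∧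
         d '' ((𝓡∂ 2).boundary (Metric.closedBall (0 : EuclideanSpace ℝ (Fin 2)) 1)) = c ∧
         Set.range d ∩ F = c
     let NonSep : Set X → Prop := fun c => IsConnected (F \ c)
     ∃ (p : Fin 3) (c c' : Set X), IsCurve c ∧ IsCurve c' ∧ Disjoint c c' ∧ NonSep c ∧ NonSep c' ∧
       BoundsDisc (H p) c ∧ ∀ q : Fin 3, q ≠ p → BoundsDisc (H q) c') →
    X ≃ₕ 𝕊 4 → Nonempty (X ≃ₘ⟮𝓡 4, 𝓡 4⟯ (𝕊 4))

/-- Sanity link (PROVED): the fact is a consequence of the smooth 4-dimensional Poincaré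
conjecture in its homotopy-sphere form "every closed smooth `X ≃ₕ S⁴` is diffeomorphic to `S⁴`"
— so, as a route input, it is summit-safe (it cannot contradict the Statement). [folklore] -/
theorem az2025_weaklyReducible_genusThree_homotopySphere_gk_of_smoothPoincare
    (hSPC : ∀ (X : Type u) [TopologicalSpace X] [T2Space X] [SecondCountableTopology X]
      [ChartedSpace (𝔼 4) X] [IsManifold (𝓡 4) ∞ X] [CompactSpace X],
      X ≃ₕ 𝕊 4 → Nonempty (X ≃ₘ⟮𝓡 4, 𝓡 4⟯ (𝕊 4))) :
    az2025_weaklyReducible_genusThree_homotopySphere_gk.{u} := by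
  intro X _ _ _ _ _ _ _ _o k S _hT _hwr e
  exact hSPC X e

/-! ### Dedup record: the three vendorings of AZ25 Thm 1.3 (homotopy-sphere corollary) coincide -/

/-- **Dedup record (PROVED): this fact IS the topic fact
`Literature.Topology.FourManifolds.arandaZupan_genus_three_weaklyReducible_homotopySphere_gk`**
(`WeaklyReducibleTrisections.lean`), at every universe. The topic fact states weak reducibility
through `Literature.Topology.FourManifolds.Trisection.IsWeaklyReducible S`, which unfolds by
`rfl` (`Trisection.isWeaklyReducible_iff`) to the inline `let`-block used here, so the two closed
statements are definitionally equal and the equivalence is `Iff.rfl`. Consequently a discharge of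
either name discharges the other in one line. [cite: ArandaZupan2025, Thm. 1.3 (p. 2) and §2 (p. 6)] -/
theorem az2025_weaklyReducible_genusThree_homotopySphere_gk_iff_topic :
    az2025_weaklyReducible_genusThree_homotopySphere_gk.{u} ↔
      Literature.Topology.FourManifolds.arandaZupan_genus_three_weaklyReducible_homotopySphere_gk.{u} :=
  Iff.rfl

/-- **Dedup record (PROVED): at universe `0` this fact is equivalent to the route-shaped vendoring
`Literature.Topology.FourManifolds.arandaZupan_weaklyReducible_genusThree_homotopySphere`**
(`WeaklyReducibleGenusThreeTrisections.lean`: bare binders `M ≃ₕ S⁴`, no compactness /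
connectedness / orientation hypotheses — verbatim the route item `GenusThreeBase`). Forward: a
Hausdorff second-countable smooth `M ≃ₕ S⁴` is compact
(`Literature.Topology.FourManifolds.compactSpace_of_homotopyEquiv_sphere_four_holds`, Hatcher
Prop. 3.29), simply connected (transported from `S⁴`,
`Literature.Topology.FourManifolds.simplyConnectedSpace_sphere_four_holds`) hence connected, and
smoothly orientable
(`Literature.Topology.FourManifolds.isOrientable_of_homotopyEquiv_sphere_four_holds`, Lee
Thm. 15.43) — all PROVED tree theorems — so this fact applies; backward: drop the extra
hypotheses. (Same argument as `genusThreeBase_iff_az2025` on the Summits side.)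
[cite: ArandaZupan2025, Thm. 1.3 (p. 2)] [cite: HatcherAT2002, Prop. 3.29] [cite: LeeSmoothManifolds2013, Thm. 15.43] -/
theorem az2025_weaklyReducible_genusThree_homotopySphere_gk_iff_routeShape :
    az2025_weaklyReducible_genusThree_homotopySphere_gk.{0} ↔
      Literature.Topology.FourManifolds.arandaZupan_weaklyReducible_genusThree_homotopySphere := by
  constructor
  · intro hAZ M _ _ _ _ _ e k T hT hwr
    haveI : CompactSpace M :=
      Literature.Topology.FourManifolds.compactSpace_of_homotopyEquiv_sphere_four_holds M e
    haveI : SimplyConnectedSpace (𝕊 4) :=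
      Literature.Topology.FourManifolds.simplyConnectedSpace_sphere_four_holds
    haveI : SimplyConnectedSpace M := e.simplyConnectedSpace
    obtain ⟨o⟩ :=
      Literature.Topology.FourManifolds.isOrientable_of_homotopyEquiv_sphere_four_holds M e
    exact hAZ M o k T hT hwr e
  · intro h X _ _ _ _ _ _ _ _o k S hT hwr e
    exact h X e k S hT hwr

/-- Hence the three vendorings are discharged together: the topic fact (any universe) gives this
fact, and this fact at universe `0` gives the route-shaped one. [cite: ArandaZupan2025, Thm. 1.3 (p. 2)] -/
theorem arandaZupan_routeShape_of_topic
    (h : Literature.Topology.FourManifolds.arandaZupan_genus_three_weaklyReducible_homotopySphere_gk.{0}) :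
    Literature.Topology.FourManifolds.arandaZupan_weaklyReducible_genusThree_homotopySphere :=
  az2025_weaklyReducible_genusThree_homotopySphere_gk_iff_routeShape.mp
    (az2025_weaklyReducible_genusThree_homotopySphere_gk_iff_topic.mpr h)

/-! ### Reduction of the fact to its core case (PROVED): labels fixed, balanced type `(3; 1,1,1)`

Aranda–Zupan fix the labelling — `c` compresses in `H_α`, `c'` in `H_β` and `H_γ` (§2, p. 6) —
while the fact quantifies over the label `p` of the handlebody in which `c` compresses.
Relabelling the sectors by a permutation `σ` (`IsGKTrisection.comp_perm`) fixes the central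
surface and relabels the handlebodies of the spine (`spineHandlebody (S ∘ σ) p =
spineHandlebody S (σ p)`), so curves, compressing discs, non-separation and weak reducibility are
invariant (`Trisection.isWeaklyReducible_comp_perm`) and the fact follows from its instance with
the labels fixed, `c` compressing in `H_0 = S 1 ∩ S 2` and `c'` in `H_1`, `H_2`
(`az2025_weaklyReducible_genusThree_homotopySphere_gk_of_zero`, transposition `(0 p)`).
For HOMOTOPY 4-spheres, moreover, the PROVED Euler-characteristic theorem
`Literature.Topology.FourManifolds.gkTrisection_genus_eq_sum_of_homotopyEquiv_sphere_holds`
(`g = k₀ + k₁ + k₂`; Gay–Kirby Remark 2, Meier–Schirmer–Zupan Remark 3.12) leaves at genus `3`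
only the types `(3; 3,0,0)`, `(3; 2,1,0)` up to relabelling — inside the range "some
`kᵢ ≥ g - 1`" of the sibling fact `msz_homotopySphere_gk` (Meier–Schirmer–Zupan Thm. 1.2) — and
the balanced type `(3; 1,1,1)`.  Hence, GIVEN `msz_homotopySphere_gk`, the fact is EQUIVALENT to
its balanced instance with fixed labels
(`az2025_weaklyReducible_genusThree_homotopySphere_gk_of_msz_of_balanced` and the trivial
converse `az2025_weaklyReducible_genusThree_homotopySphere_gk.balanced_zero`): the outstanding
content of the fact is exactly "a closed connected oriented smooth `X ≃ₕ S⁴` with a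
`(3; 1,1,1)`-trisection admitting disjoint non-separating curves `c`, `c'` on `Σ`, `c`
compressing in `S 1 ∩ S 2` and `c'` in `S 0 ∩ S 2` and in `S 0 ∩ S 1`, is diffeomorphic to
`S⁴`".  In Aranda–Zupan's proof (§6, pp. 21–24) this is the case `(k₁, k₂) = (1, 1)`: `T` is
reducible (then `X = X' # X''` with trisections of genus `1` and `2`, [MZ17b]) or contains a
five-chain (then `X` is `S_p` or `S'_p` by Prop. 5.5, and `π₁(S_p) = ℤ/p`). -/

section Reduction

open Literature.Topology.FourManifolds Literature.Topology.FourManifolds.Trisection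

/-- Relabelling the sectors fixes the central surface `Σ = ⋂ l, S l`. [folklore] -/
theorem Trisection.centralSurfaceSet_comp_perm {X : Type u} (S : Fin 3 → Set X)
    (σ : Equiv.Perm (Fin 3)) : centralSurfaceSet (S ∘ σ) = centralSurfaceSet S :=
  σ.surjective.iInter_comp S

/-- Relabelling the sectors by `σ` relabels the handlebodies of the spine: the handlebody of
`S ∘ σ` opposite `p` is the handlebody of `S` opposite `σ p`. [folklore] -/
theorem Trisection.spineHandlebody_comp_perm {X : Type u} (S : Fin 3 → Set X)
    (σ : Equiv.Perm (Fin 3)) (p : Fin 3) :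
    spineHandlebody (S ∘ σ) p = spineHandlebody S (σ p) := by
  ext x
  simp only [spineHandlebody, mem_iInter, Function.comp_apply]
  refine ⟨fun h m hm => ?_, fun h l hl => h (σ l) fun heq => hl (σ.injective heq)⟩
  simpa using h (σ.symm m) fun heq => hm (σ.symm_apply_eq.mp heq)

/-- Non-separation of a curve on `Σ` does not depend on the labelling of the sectors.
[folklore] -/
theorem Trisection.isNonSeparating_comp_perm {X : Type u} [TopologicalSpace X]
    (S : Fin 3 → Set X) (σ : Equiv.Perm (Fin 3)) (c : Set X) :
    IsNonSeparating (S ∘ σ) c ↔ IsNonSeparating S c := by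
  unfold IsNonSeparating
  rw [Trisection.centralSurfaceSet_comp_perm]

/-- Being a curve on `Σ` does not depend on the labelling of the sectors. [folklore] -/
theorem Trisection.isCurve_comp_perm {X : Type u} [TopologicalSpace X] [ChartedSpace (𝔼 4) X]
    (S : Fin 3 → Set X) (σ : Equiv.Perm (Fin 3)) (c : Set X) :
    IsCurve (S ∘ σ) c ↔ IsCurve S c := by
  unfold IsCurve
  rw [Trisection.centralSurfaceSet_comp_perm]

/-- Bounding a properly embedded disc in `A` (relative to `Σ`) does not depend on the labelling
of the sectors. [folklore] -/
theorem Trisection.boundsDisc_comp_perm {X : Type u} [TopologicalSpace X]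
    [ChartedSpace (𝔼 4) X] (S : Fin 3 → Set X) (σ : Equiv.Perm (Fin 3)) (A c : Set X) :
    BoundsDisc (S ∘ σ) A c ↔ BoundsDisc S A c := by
  unfold BoundsDisc
  rw [Trisection.centralSurfaceSet_comp_perm]

/-- **Weak reducibility is invariant under relabelling the sectors** (the weak reduction of
`S ∘ σ` at the label `p` is the weak reduction of `S` at `σ p`). [cite: ArandaZupan2025, §2 (p. 6)] -/
theorem Trisection.isWeaklyReducible_comp_perm {X : Type u} [TopologicalSpace X]
    [ChartedSpace (𝔼 4) X] (S : Fin 3 → Set X) (σ : Equiv.Perm (Fin 3)) :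
    IsWeaklyReducible (S ∘ σ) ↔ IsWeaklyReducible S := by
  constructor
  · rintro ⟨p, c, c', hc, hc', hd, hn, hn', hb, hb'⟩
    refine ⟨σ p, c, c', (Trisection.isCurve_comp_perm S σ c).1 hc,
      (Trisection.isCurve_comp_perm S σ c').1 hc', hd,
      (Trisection.isNonSeparating_comp_perm S σ c).1 hn,
      (Trisection.isNonSeparating_comp_perm S σ c').1 hn', ?_, fun q hq => ?_⟩
    · rwa [Trisection.spineHandlebody_comp_perm, Trisection.boundsDisc_comp_perm] at hb
    · have h := hb' (σ.symm q) fun heq => hq (σ.symm_apply_eq.mp heq)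
      rwa [Trisection.spineHandlebody_comp_perm, Trisection.boundsDisc_comp_perm,
        Equiv.apply_symm_apply] at h
  · rintro ⟨p, c, c', hc, hc', hd, hn, hn', hb, hb'⟩
    refine ⟨σ.symm p, c, c', (Trisection.isCurve_comp_perm S σ c).2 hc,
      (Trisection.isCurve_comp_perm S σ c').2 hc', hd,
      (Trisection.isNonSeparating_comp_perm S σ c).2 hn,
      (Trisection.isNonSeparating_comp_perm S σ c').2 hn', ?_, fun q hq => ?_⟩
    · rw [Trisection.spineHandlebody_comp_perm, Trisection.boundsDisc_comp_perm,
        Equiv.apply_symm_apply]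
      exact hb
    · rw [Trisection.spineHandlebody_comp_perm, Trisection.boundsDisc_comp_perm]
      exact hb' (σ q) fun heq => hq (σ.eq_symm_apply.mpr heq)

/-- **Fixed labels suffice (PROVED).** If the conclusion holds whenever `c` compresses in
`H_0 = S 1 ∩ S 2` and `c'` in `H_1 = S 0 ∩ S 2` and `H_2 = S 0 ∩ S 1` (any `k`), then the fact
holds: relabel the sectors by the transposition `(0 p)` (`IsGKTrisection.comp_perm`), which
carries the handlebody `H_p` of `S` to the handlebody `H_0` of `S ∘ (0 p)` and fixes `Σ`.
[cite: ArandaZupan2025, §2 (p. 6)] [cite: GayKirby2016, Def. 1] -/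
theorem az2025_weaklyReducible_genusThree_homotopySphere_gk_of_zero
    (h0 : ∀ (X : Type u) [TopologicalSpace X] [T2Space X] [SecondCountableTopology X]
      [ChartedSpace (𝔼 4) X] [IsManifold (𝓡 4) ∞ X] [CompactSpace X] [ConnectedSpace X]
      (_ : SmoothOrientation (𝓡 4) X) (k : Fin 3 → ℕ) (S : Fin 3 → Set X),
      IsGKTrisection X 3 k S →
      (∃ c c' : Set X, IsCurve S c ∧ IsCurve S c' ∧ Disjoint c c' ∧
        IsNonSeparating S c ∧ IsNonSeparating S c' ∧
        BoundsDisc S (spineHandlebody S 0) c ∧ BoundsDisc S (spineHandlebody S 1) c' ∧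
        BoundsDisc S (spineHandlebody S 2) c') →
      X ≃ₕ 𝕊 4 → Nonempty (X ≃ₘ⟮𝓡 4, 𝓡 4⟯ (𝕊 4))) :
    az2025_weaklyReducible_genusThree_homotopySphere_gk.{u} := by
  intro X _ _ _ _ _ _ _ o k S hT hwr e
  have hwr' : IsWeaklyReducible S := hwr
  obtain ⟨p, c, c', hc, hc', hd, hn, hn', hb, hb'⟩ := hwr'
  have hσ0 : Equiv.swap (0 : Fin 3) p 0 = p := Equiv.swap_apply_left 0 p
  have hne : ∀ q : Fin 3, q ≠ 0 → Equiv.swap (0 : Fin 3) p q ≠ p := fun q hq heq =>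
    hq ((Equiv.swap (0 : Fin 3) p).injective (heq.trans hσ0.symm))
  refine h0 X o (k ∘ Equiv.swap 0 p) (S ∘ Equiv.swap 0 p) (hT.comp_perm _)
    ⟨c, c', (Trisection.isCurve_comp_perm S _ c).2 hc,
      (Trisection.isCurve_comp_perm S _ c').2 hc', hd,
      (Trisection.isNonSeparating_comp_perm S _ c).2 hn,
      (Trisection.isNonSeparating_comp_perm S _ c').2 hn', ?_, ?_, ?_⟩ e
  · rw [Trisection.spineHandlebody_comp_perm, Trisection.boundsDisc_comp_perm, hσ0]
    exact hb
  · rw [Trisection.spineHandlebody_comp_perm, Trisection.boundsDisc_comp_perm]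
    exact hb' _ (hne 1 (by decide))
  · rw [Trisection.spineHandlebody_comp_perm, Trisection.boundsDisc_comp_perm]
    exact hb' _ (hne 2 (by decide))

/-- **Reduction to the balanced type `(3; 1,1,1)` (PROVED from the sibling fact
`msz_homotopySphere_gk` and the proved Euler-characteristic theorem).**  GIVEN
Meier–Schirmer–Zupan's homotopy-sphere fact (hypothesis `hMSZ`, D-0014), the fact follows from
its instance for BALANCED `(3; 1,1,1)`-trisections with fixed labels: a `(3; k₀,k₁,k₂)`-trisected
`X ≃ₕ S⁴` has `3 = k₀ + k₁ + k₂`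
(`Literature.Topology.FourManifolds.gkTrisection_genus_eq_sum_of_homotopyEquiv_sphere_holds`),
so either some `kᵢ ≥ 2 = g - 1` and `hMSZ` applies (weak reducibility unused), or
`k = (1,1,1)`.  In Aranda–Zupan's proof this is the case `(k₁, k₂) = (1, 1)` of §6 (p. 24).
[cite: ArandaZupan2025, Thm. 1.3 (p. 2) and §6 (p. 24)] [cite: MeierSchirmerZupan2016, Thm. 1.2 and Remark 3.12] [cite: GayKirby2016, Remark 2] -/
theorem az2025_weaklyReducible_genusThree_homotopySphere_gk_of_msz_of_balanced
    (hMSZ : msz_homotopySphere_gk.{u})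
    (h1 : ∀ (X : Type u) [TopologicalSpace X] [T2Space X] [SecondCountableTopology X]
      [ChartedSpace (𝔼 4) X] [IsManifold (𝓡 4) ∞ X] [CompactSpace X] [ConnectedSpace X]
      (_ : SmoothOrientation (𝓡 4) X) (S : Fin 3 → Set X),
      IsBalancedGKTrisection X 3 1 S →
      (∃ c c' : Set X, IsCurve S c ∧ IsCurve S c' ∧ Disjoint c c' ∧
        IsNonSeparating S c ∧ IsNonSeparating S c' ∧
        BoundsDisc S (spineHandlebody S 0) c ∧ BoundsDisc S (spineHandlebody S 1) c' ∧
        BoundsDisc S (spineHandlebody S 2) c') →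
      X ≃ₕ 𝕊 4 → Nonempty (X ≃ₘ⟮𝓡 4, 𝓡 4⟯ (𝕊 4))) :
    az2025_weaklyReducible_genusThree_homotopySphere_gk.{u} := by
  refine az2025_weaklyReducible_genusThree_homotopySphere_gk_of_zero
    fun X _ _ _ _ _ _ _ o k S hT hwr e => ?_
  by_cases hk : ∃ i, 3 ≤ k i + 1
  · exact hMSZ X o 3 k S hT hk e
  · push Not at hk
    have hsum : 3 = k 0 + k 1 + k 2 :=
      gkTrisection_genus_eq_sum_of_homotopyEquiv_sphere_holds X o 3 k S hT e
    have hk0 := hk 0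
    have hk1 := hk 1
    have hk2 := hk 2
    obtain rfl : k = fun _ => 1 := by
      funext i
      fin_cases i <;> simp only [Fin.zero_eta, Fin.mk_one, Fin.reduceFinMk] <;> omega
    exact h1 X o S hT hwr e

/-- The trivial converse: the fact contains its balanced instance with fixed labels (so that,
GIVEN `msz_homotopySphere_gk`, the two are equivalent). [cite: ArandaZupan2025, Thm. 1.3 (p. 2)] -/
theorem az2025_weaklyReducible_genusThree_homotopySphere_gk.balanced_zero
    (h : az2025_weaklyReducible_genusThree_homotopySphere_gk.{u})
    (X : Type u) [TopologicalSpace X] [T2Space X] [SecondCountableTopology X]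
    [ChartedSpace (𝔼 4) X] [IsManifold (𝓡 4) ∞ X] [CompactSpace X] [ConnectedSpace X]
    (o : SmoothOrientation (𝓡 4) X) (S : Fin 3 → Set X) (hT : IsBalancedGKTrisection X 3 1 S)
    (hwr : ∃ c c' : Set X, IsCurve S c ∧ IsCurve S c' ∧ Disjoint c c' ∧
      IsNonSeparating S c ∧ IsNonSeparating S c' ∧
      BoundsDisc S (spineHandlebody S 0) c ∧ BoundsDisc S (spineHandlebody S 1) c' ∧
      BoundsDisc S (spineHandlebody S 2) c')
    (e : X ≃ₕ 𝕊 4) : Nonempty (X ≃ₘ⟮𝓡 4, 𝓡 4⟯ (𝕊 4)) := by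
  obtain ⟨c, c', hc, hc', hd, hn, hn', hb0, hb1, hb2⟩ := hwr
  refine h X o (fun _ => 1) S hT.isGKTrisection ⟨0, c, c', hc, hc', hd, hn, hn', hb0, ?_⟩ e
  intro q hq
  fin_cases q
  · exact absurd rfl hq
  · exact hb1
  · exact hb2

end Reduction

/-! ### The reducible branch runs on vendored facts (PROVED); what is left is Aranda–Zupan's
irreducible (five-chain) case

Aranda–Zupan's proof of Thm. 1.3 opens (§6, p. 20, verbatim): "If `T` is reducible, then `X`
can be expressed as a connected sum `X′ # X″`, where `X′` admits a genus-one trisection and `X″`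
admits a genus-two trisection. By the main theorem in [MZ17b], it follows that `X` is `S⁴` or a
connected sum of copies of `±ℂP²`, `S¹ × S³`, and `S² × S²`."  For a HOMOTOPY 4-sphere this
branch runs entirely on statements the tree already carries, as named facts or theorems:

* the splitting of reducible trisections (`ReducibleTrisectionSplitting.lean`, AZ25 §2 p. 6, both
  named facts): a SEPARATING reducing curve gives `X = X₁ # X₂` with trisections of genera
  `g₁ + g₂ = 3`, `g₁, g₂ ≥ 1` — hence `≤ 2`
  (`Literature.Topology.FourManifolds.Trisection.isConnectedSum_of_reducing_separating`); a
  NON-SEPARATING one gives `X = X₁ # (S¹ × S³)`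
  (`Literature.Topology.FourManifolds.Trisection.isConnectedSum_circleProd_of_reducing_nonseparating`),
  impossible for simply connected `X`: summands of simply connected sums are simply connected
  (`IsConnectedSum.simplyConnectedSpace_right`, PROVED, Kosinski VI §2) while `π₁(S¹ × S³) ≠ 1`
  (`not_simplyConnectedSpace_circle_prod_sphereThree`, proved here);
* Kosinski's Prop. VI.2.1, a summand of a homotopy 4-sphere is a homotopy 4-sphere (named fact
  `Literature.Topology.FourManifolds.nonempty_homotopyEquiv_sphere_four_left_of_isConnectedSum`,
  `HomotopySphereSummands.lean`; proved at universe `0` modulo the characterisation of homotopy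
  4-spheres, `HomotopySphereSummandsHolds.lean`): `X₁, X₂ ≃ₕ S⁴`;
* the genus-`≤ 2` fact `mz_genus_le_two_homotopySphere_gk` — a consequence of
  `msz_homotopySphere_gk` alone (`mz_genus_le_two_homotopySphere_gk_of_msz_alone`, PROVED):
  `Xᵢ ≅ S⁴` (orientations of the summands from `X₁, X₂ ≃ₕ S⁴`, Lee Thm. 15.43, PROVED);
* `S⁴ # S⁴ ≅ S⁴` (`Literature.Topology.FourManifolds.connectedSum_sphere_sphere_holds`, PROVED;
  Kervaire–Milnor Lemma 2.1).

Hence `nonempty_diffeomorph_sphere_of_isReducible_genusThree_of_facts`: GIVEN the two splitting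
facts, Kosinski's fact and `mz_genus_le_two_homotopySphere_gk`, a homotopy 4-sphere with a
REDUCIBLE genus-`3` trisection (`Trisection.IsReducible`) is `S⁴`; and
`az2025_weaklyReducible_genusThree_homotopySphere_gk_of_facts_of_irreducible`: GIVEN
`msz_homotopySphere_gk`, the two splitting facts and Kosinski's, the fact REDUCES to its instance
for balanced `(3; 1,1,1)`-trisections with fixed labels that are weakly reducible but NOT
reducible.  That instance is exactly the second half of Aranda–Zupan's dichotomy at
`(k₁, k₂) = (1, 1)`: by Prop. 3.9 and §6 (pp. 20–24) an irreducible weakly reducible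
`(3; 1,1,1)`-trisection has `Y = S¹ × S²` in its normal form (the cases `Y = S³`, `Y = L(p,q)`
end with "`T` is reducible", p. 22) and then contains a five-chain (pp. 22–24, via Property R,
Cho–Koda's lemmas and an intersection-matrix count); five-chain surgery (Lemma 5.4) yields a
`(2; 1,1,2)`-trisection, of `S¹ × S³` by [MZ17b], and `X` is obtained by surgery on a loop in
`S¹ × S³` (Prop. 5.5), "implying that `X` is diffeomorphic to `S_p` or `S′_p`" (p. 24), with
`π₁ = ℤ/p` (Lemma 2.7) — so for a homotopy sphere `p = ±1` and "`S_1` and `S′_1` are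
diffeomorphic to `S⁴`" (p. 7).  None of that second half (thin position and untelescoping,
Cho–Koda's genus-two lemmas, Heegaard triples and waves, five-chains and five-chain surgery,
loop surgery on `S¹ × S³` and Pao's siblings, and underneath it all Waldhausen's theorem and the
passage trisection diagram ↦ trisection) has a counterpart in the tree; it is the outstanding
content of the fact and is NOT restated here as a named fact (D-0026). -/

section ReducibleBranch

open Literature.Topology.FourManifolds Literature.Topology.FourManifolds.Trisection

/-- **`π₁(S¹ × S³) ≠ 1`**: Mathlib's `Circle × 𝕊³` is not simply connected — read the circle
coordinate in `ℝ/2πℤ` (`AddCircle.homeomorphCircle'`); the loop `t ↦ (2πt mod 2π, q₀)` carries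
the non-closing real lift `t ↦ 2πt` of that coordinate, which a simply connected space forbids
(tree lemma `Literature.AlgebraicTopology.FundamentalGroup.AddCircle.not_simplyConnectedSpace_of_lift`,
Hatcher Prop. 1.30 with Thm. 1.7). [cite: HatcherAT2002, Thm. 1.7 and Prop. 1.30] -/
theorem not_simplyConnectedSpace_circle_prod_sphereThree :
    ¬ SimplyConnectedSpace (Circle × (𝕊 3)) := by
  intro hsc
  haveI := hsc
  let q₀ : 𝕊 3 := ⟨EuclideanSpace.single 0 1, by simp⟩
  let e : (AddCircle (2 * Real.pi) × (𝕊 3)) ≃ₜ (Circle × (𝕊 3)) :=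
    Homeomorph.prodCongr AddCircle.homeomorphCircle' (Homeomorph.refl _)
  haveI : SimplyConnectedSpace (AddCircle (2 * Real.pi) × (𝕊 3)) :=
    e.toHomotopyEquiv.simplyConnectedSpace
  let g : C(AddCircle (2 * Real.pi) × (𝕊 3), AddCircle (2 * Real.pi)) :=
    ⟨Prod.fst, continuous_fst⟩
  let γ : Path (((0 : ℝ) : AddCircle (2 * Real.pi)), q₀) (((0 : ℝ) : AddCircle (2 * Real.pi)), q₀) :=
    { toFun := fun t => ((((t : ℝ) * (2 * Real.pi) : ℝ) : AddCircle (2 * Real.pi)), q₀)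
      continuous_toFun := by fun_prop
      source' := by simp
      target' := by simp }
  exact Literature.AlgebraicTopology.FundamentalGroup.AddCircle.not_simplyConnectedSpace_of_lift
    g γ (G := fun t => (t : ℝ) * (2 * Real.pi)) (by fun_prop) (fun _ => rfl)
    (by simp [Real.pi_ne_zero]) inferInstance

/-- **The reducible branch for homotopy 4-spheres, from the tree's facts (PROVED glue).**  GIVEN
the two splitting facts for reducible trisections (Aranda–Zupan 2025 §2 p. 6, both cases),
Kosinski's Prop. VI.2.1 (a summand of a homotopy 4-sphere is a homotopy 4-sphere) and the
genus-`≤ 2` fact `mz_genus_le_two_homotopySphere_gk` (Meier–Zupan / Meier–Schirmer–Zupan): a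
closed connected oriented smooth `X ≃ₕ S⁴` with a REDUCIBLE genus-`3` trisection is
diffeomorphic to `S⁴`.  A non-separating reducing curve would make `S¹ × S³` a summand of the
simply connected `X` (`IsConnectedSum.simplyConnectedSpace_right`,
`not_simplyConnectedSpace_circle_prod_sphereThree`); a separating one writes `X = X₁ # X₂` with
trisections of genera `g₁ + g₂ = 3`, `gᵢ ≥ 1`, so `gᵢ ≤ 2`, the summands are homotopy spheres
(Kosinski), oriented by Lee's Thm. 15.43 (`isOrientable_of_homotopyEquiv_sphere_four_holds`),
hence `≅ S⁴` by the genus-`≤ 2` fact, and `X ≅ S⁴ # S⁴ ≅ S⁴` (`connectedSum_sphere_sphere_holds`).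
This is the first paragraph of the printed proof of Thm. 1.3 (§6, p. 20) for homotopy spheres.
[cite: ArandaZupan2025, §6 (p. 20, reducible case) and §2 (p. 6)] [cite: Kosinski1993, Ch. VI §2, Prop. 2.1] [cite: MeierZupan2017, Thm. 1.2] [cite: KervaireMilnor1963, §2, Lemma 2.1] -/
theorem nonempty_diffeomorph_sphere_of_isReducible_genusThree_of_facts
    (hsep : isConnectedSum_of_reducing_separating.{u})
    (hns : isConnectedSum_circleProd_of_reducing_nonseparating.{u})
    (hK : nonempty_homotopyEquiv_sphere_four_left_of_isConnectedSum.{u})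
    (hMZ : mz_genus_le_two_homotopySphere_gk.{u})
    (X : Type u) [TopologicalSpace X] [T2Space X] [SecondCountableTopology X]
    [ChartedSpace (𝔼 4) X] [IsManifold (𝓡 4) ∞ X] [CompactSpace X] [ConnectedSpace X]
    (o : SmoothOrientation (𝓡 4) X) (k : Fin 3 → ℕ) (S : Fin 3 → Set X)
    (hT : IsGKTrisection X 3 k S) (hred : IsReducible S) (e : X ≃ₕ 𝕊 4) :
    Nonempty (X ≃ₘ⟮𝓡 4, 𝓡 4⟯ (𝕊 4)) := by
  haveI : SimplyConnectedSpace (𝕊 4) := simplyConnectedSpace_sphere_four_holds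
  haveI : SimplyConnectedSpace X := e.simplyConnectedSpace
  obtain ⟨δ, hc, hess, hd⟩ := hred
  by_cases hn : IsNonSeparating S δ
  · -- non-separating reducing curve: `X = X₁ # (S¹ × S³)`, but `X` is simply connected
    obtain ⟨X₁, _, _, _, _, _, _, _, g₁, k₁, S₁, -, -, -, hP⟩ :=
      hns X o 3 k S δ hT hc hess hd hn
    have h4 : 1 < Module.finrank ℝ (𝔼 4) := by
      rw [finrank_euclideanSpace_fin]; norm_num
    exact absurd (hP.simplyConnectedSpace_right h4)
      not_simplyConnectedSpace_circle_prod_sphereThree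
  · -- separating reducing curve: `X = X₁ # X₂`, genera `g₁ + g₂ = 3`, `gᵢ ≥ 1`
    obtain ⟨X₁, _, _, _, _, _, _, _, X₂, _, _, _, _, _, _, _, g₁, g₂, k₁, k₂, S₁, S₂, hT₁, hT₂,
      hg, hg₁, hg₂, -, hP⟩ := hsep X o 3 k S δ hT hc hess hd hn
    obtain ⟨e₁⟩ := hK X₁ X₂ X hP e
    obtain ⟨e₂⟩ := hK X₂ X₁ X hP.symm e
    obtain ⟨o₁⟩ := isOrientable_of_homotopyEquiv_sphere_four_holds X₁ e₁
    obtain ⟨o₂⟩ := isOrientable_of_homotopyEquiv_sphere_four_holds X₂ e₂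
    have h₁ : Nonempty (X₁ ≃ₘ⟮𝓡 4, 𝓡 4⟯ (𝕊 4)) := hMZ X₁ o₁ g₁ k₁ S₁ hT₁ (by omega) e₁
    have h₂ : Nonempty (X₂ ≃ₘ⟮𝓡 4, 𝓡 4⟯ (𝕊 4)) := hMZ X₂ o₂ g₂ k₂ S₂ hT₂ (by omega) e₂
    exact connectedSum_sphere_sphere_holds 4 (by norm_num) X₁ X₂ X hP h₁ h₂

/-- **Reduction of the fact to Aranda–Zupan's irreducible case (PROVED glue).**  GIVEN
Meier–Schirmer–Zupan's homotopy-sphere fact `msz_homotopySphere_gk` (the unbalanced genus-`3`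
types and, through `mz_genus_le_two_homotopySphere_gk_of_msz_alone`, the genus-`≤ 2` summands),
the two splitting facts for reducible trisections and Kosinski's Prop. VI.2.1, the fact follows
from its instance for BALANCED `(3; 1,1,1)`-trisections with fixed labels (`c` compressing in
`S 1 ∩ S 2`, `c′` in `S 0 ∩ S 2` and `S 0 ∩ S 1`) that are NOT reducible (hypothesis `hirr`):
combine `az2025_weaklyReducible_genusThree_homotopySphere_gk_of_msz_of_balanced` with
`nonempty_diffeomorph_sphere_of_isReducible_genusThree_of_facts`.  In the printed proof `hirr` is
the five-chain half of the dichotomy for `(k₁, k₂) = (1, 1)` (Prop. 3.9, §6 pp. 20–24, Lemma 5.4,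
Prop. 5.5): such an `X` is `S_p` or `S′_p`, `π₁ = ℤ/p`, and `S_{±1} ≅ S′_{±1} ≅ S⁴` (p. 7) — the
part of Aranda–Zupan's theorem with no counterpart in the tree.
[cite: ArandaZupan2025, Thm. 1.3 (p. 2), §6 (pp. 20–24), Prop. 5.5] [cite: MeierSchirmerZupan2016, Thm. 1.2] [cite: Kosinski1993, Ch. VI §2, Prop. 2.1] -/
theorem az2025_weaklyReducible_genusThree_homotopySphere_gk_of_facts_of_irreducible
    (hMSZ : msz_homotopySphere_gk.{u})
    (hsep : isConnectedSum_of_reducing_separating.{u})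
    (hns : isConnectedSum_circleProd_of_reducing_nonseparating.{u})
    (hK : nonempty_homotopyEquiv_sphere_four_left_of_isConnectedSum.{u})
    (hirr : ∀ (X : Type u) [TopologicalSpace X] [T2Space X] [SecondCountableTopology X]
      [ChartedSpace (𝔼 4) X] [IsManifold (𝓡 4) ∞ X] [CompactSpace X] [ConnectedSpace X]
      (_ : SmoothOrientation (𝓡 4) X) (S : Fin 3 → Set X),
      IsBalancedGKTrisection X 3 1 S →
      (∃ c c' : Set X, IsCurve S c ∧ IsCurve S c' ∧ Disjoint c c' ∧
        IsNonSeparating S c ∧ IsNonSeparating S c' ∧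
        BoundsDisc S (spineHandlebody S 0) c ∧ BoundsDisc S (spineHandlebody S 1) c' ∧
        BoundsDisc S (spineHandlebody S 2) c') →
      ¬ IsReducible S → X ≃ₕ 𝕊 4 → Nonempty (X ≃ₘ⟮𝓡 4, 𝓡 4⟯ (𝕊 4))) :
    az2025_weaklyReducible_genusThree_homotopySphere_gk.{u} := by
  refine az2025_weaklyReducible_genusThree_homotopySphere_gk_of_msz_of_balanced hMSZ
    fun X _ _ _ _ _ _ _ o S hT hwr e => ?_
  by_cases hred : IsReducible S
  · exact nonempty_diffeomorph_sphere_of_isReducible_genusThree_of_facts hsep hns hK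
      (mz_genus_le_two_homotopySphere_gk_of_msz_alone hMSZ) X o (fun _ => 1) S
      hT.isGKTrisection hred e
  · exact hirr X o S hT hwr hred e

/-- **The reducible branch, unconditional in Kosinski** (PROVED glue): Kosinski's summand fact
is discharged in the tree at every universe
(`nonempty_homotopyEquiv_sphere_four_left_of_isConnectedSum_holds`), so GIVEN only the two
splitting facts for reducible trisections (Aranda–Zupan 2025 §2 p. 6) and the genus-`≤ 2` fact, a
closed connected oriented smooth `X ≃ₕ S⁴` with a REDUCIBLE genus-`3` trisection is `S⁴`.
[cite: ArandaZupan2025, §6 (p. 20, reducible case) and §2 (p. 6)] [cite: Kosinski1993, Ch. VI §2, Prop. 2.1] [cite: MeierZupan2017, Thm. 1.2] -/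
theorem nonempty_diffeomorph_sphere_of_isReducible_genusThree_of_splitting
    (hsep : isConnectedSum_of_reducing_separating.{u})
    (hns : isConnectedSum_circleProd_of_reducing_nonseparating.{u})
    (hMZ : mz_genus_le_two_homotopySphere_gk.{u})
    (X : Type u) [TopologicalSpace X] [T2Space X] [SecondCountableTopology X]
    [ChartedSpace (𝔼 4) X] [IsManifold (𝓡 4) ∞ X] [CompactSpace X] [ConnectedSpace X]
    (o : SmoothOrientation (𝓡 4) X) (k : Fin 3 → ℕ) (S : Fin 3 → Set X)
    (hT : IsGKTrisection X 3 k S) (hred : IsReducible S) (e : X ≃ₕ 𝕊 4) :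
    Nonempty (X ≃ₘ⟮𝓡 4, 𝓡 4⟯ (𝕊 4)) :=
  nonempty_diffeomorph_sphere_of_isReducible_genusThree_of_facts hsep hns
    nonempty_homotopyEquiv_sphere_four_left_of_isConnectedSum_holds hMZ X o k S hT hred e

/-- **Where the fact stands (PROVED glue, unconditional in Kosinski):** GIVEN the THREE named
facts of the tree `msz_homotopySphere_gk` (Meier–Schirmer–Zupan Thm. 1.2, homotopy-sphere form),
`Trisection.isConnectedSum_of_reducing_separating` and
`Trisection.isConnectedSum_circleProd_of_reducing_nonseparating` (Aranda–Zupan §2 p. 6), the fact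
is implied by — and so, these facts granted, EQUIVALENT to, cf.
`az2025_weaklyReducible_genusThree_homotopySphere_gk.balanced_zero` — its instance `hirr` for
balanced `(3; 1,1,1)`-trisections with fixed labels which are weakly reducible and NOT reducible:
Aranda–Zupan's five-chain case (Prop. 3.9, §6 pp. 20–24, Lemma 5.4, Prop. 5.5, and `S_{±1} ≅ S⁴`,
p. 7), the one input of the printed proof with no counterpart in the tree.
[cite: ArandaZupan2025, Thm. 1.3 (p. 2), §6 (pp. 20–24), Prop. 5.5] [cite: MeierSchirmerZupan2016, Thm. 1.2] -/
theorem az2025_weaklyReducible_genusThree_homotopySphere_gk_of_msz_of_splitting_of_irreducible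
    (hMSZ : msz_homotopySphere_gk.{u})
    (hsep : isConnectedSum_of_reducing_separating.{u})
    (hns : isConnectedSum_circleProd_of_reducing_nonseparating.{u})
    (hirr : ∀ (X : Type u) [TopologicalSpace X] [T2Space X] [SecondCountableTopology X]
      [ChartedSpace (𝔼 4) X] [IsManifold (𝓡 4) ∞ X] [CompactSpace X] [ConnectedSpace X]
      (_ : SmoothOrientation (𝓡 4) X) (S : Fin 3 → Set X),
      IsBalancedGKTrisection X 3 1 S →
      (∃ c c' : Set X, IsCurve S c ∧ IsCurve S c' ∧ Disjoint c c' ∧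
        IsNonSeparating S c ∧ IsNonSeparating S c' ∧
        BoundsDisc S (spineHandlebody S 0) c ∧ BoundsDisc S (spineHandlebody S 1) c' ∧
        BoundsDisc S (spineHandlebody S 2) c') →
      ¬ IsReducible S → X ≃ₕ 𝕊 4 → Nonempty (X ≃ₘ⟮𝓡 4, 𝓡 4⟯ (𝕊 4))) :
    az2025_weaklyReducible_genusThree_homotopySphere_gk.{u} :=
  az2025_weaklyReducible_genusThree_homotopySphere_gk_of_facts_of_irreducible hMSZ hsep hns
    nonempty_homotopyEquiv_sphere_four_left_of_isConnectedSum_holds hirr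

/-! #### The non-separating splitting fact is not needed (π₁-obstruction proved in the tree) -/

/-- **The reducible branch needs only the SEPARATING splitting fact (PROVED glue).**  The
non-separating case of a reducing curve no longer goes through Aranda–Zupan's splitting
`X = X₁ # (S¹ × S³)` (the tree's still-unproved fact
`Trisection.isConnectedSum_circleProd_of_reducing_nonseparating`): the tree now PROVES directly
that a trisected `4`-manifold with a non-separating reducing curve is not simply connected
(`Literature.Topology.FourManifolds.Trisection.not_simplyConnectedSpace_of_reducing_nonseparating`:
the three two-sided compressing discs give circle-valued collapse maps `H_q → S¹` with a common
character of `π₁ F`, nonzero on a loop dual to the curve), which is all this branch used.  So: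
GIVEN the separating splitting fact, Kosinski's Prop. VI.2.1 and the genus-`≤ 2` fact, a closed
connected oriented smooth `X ≃ₕ S⁴` with a REDUCIBLE genus-`3` trisection is `S⁴`.
[cite: ArandaZupan2025, §6 (p. 20, reducible case) and §2 (p. 6)] [cite: Kosinski1993, Ch. VI §2, Prop. 2.1] [cite: MeierZupan2017, Thm. 1.2] -/
theorem nonempty_diffeomorph_sphere_of_isReducible_genusThree_of_separating
    (hsep : isConnectedSum_of_reducing_separating.{u})
    (hK : nonempty_homotopyEquiv_sphere_four_left_of_isConnectedSum.{u})
    (hMZ : mz_genus_le_two_homotopySphere_gk.{u})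
    (X : Type u) [TopologicalSpace X] [T2Space X] [SecondCountableTopology X]
    [ChartedSpace (𝔼 4) X] [IsManifold (𝓡 4) ∞ X] [CompactSpace X] [ConnectedSpace X]
    (o : SmoothOrientation (𝓡 4) X) (k : Fin 3 → ℕ) (S : Fin 3 → Set X)
    (hT : IsGKTrisection X 3 k S) (hred : IsReducible S) (e : X ≃ₕ 𝕊 4) :
    Nonempty (X ≃ₘ⟮𝓡 4, 𝓡 4⟯ (𝕊 4)) := by
  haveI : SimplyConnectedSpace (𝕊 4) := simplyConnectedSpace_sphere_four_holds
  haveI hX : SimplyConnectedSpace X := e.simplyConnectedSpace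
  obtain ⟨δ, hc, hess, hd⟩ := hred
  by_cases hn : IsNonSeparating S δ
  · -- non-separating reducing curve: `π₁ X ≠ 1` (proved in the tree), but `X ≃ₕ S⁴`
    exact absurd hX (not_simplyConnectedSpace_of_reducing_nonseparating hT hc hd hn)
  · -- separating reducing curve: `X = X₁ # X₂`, genera `g₁ + g₂ = 3`, `gᵢ ≥ 1`
    obtain ⟨X₁, _, _, _, _, _, _, _, X₂, _, _, _, _, _, _, _, g₁, g₂, k₁, k₂, S₁, S₂, hT₁, hT₂,
      hg, hg₁, hg₂, -, hP⟩ := hsep X o 3 k S δ hT hc hess hd hn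
    obtain ⟨e₁⟩ := hK X₁ X₂ X hP e
    obtain ⟨e₂⟩ := hK X₂ X₁ X hP.symm e
    obtain ⟨o₁⟩ := isOrientable_of_homotopyEquiv_sphere_four_holds X₁ e₁
    obtain ⟨o₂⟩ := isOrientable_of_homotopyEquiv_sphere_four_holds X₂ e₂
    have h₁ : Nonempty (X₁ ≃ₘ⟮𝓡 4, 𝓡 4⟯ (𝕊 4)) := hMZ X₁ o₁ g₁ k₁ S₁ hT₁ (by omega) e₁
    have h₂ : Nonempty (X₂ ≃ₘ⟮𝓡 4, 𝓡 4⟯ (𝕊 4)) := hMZ X₂ o₂ g₂ k₂ S₂ hT₂ (by omega) e₂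
    exact connectedSum_sphere_sphere_holds 4 (by norm_num) X₁ X₂ X hP h₁ h₂

/-- **Where the fact stands now (PROVED glue, unconditional in Kosinski and in the
non-separating reducing case):** GIVEN the TWO named facts `msz_homotopySphere_gk`
(Meier–Schirmer–Zupan Thm. 1.2, homotopy-sphere form) and
`Trisection.isConnectedSum_of_reducing_separating` (Aranda–Zupan §2 p. 6, separating case), the
fact `az2025_weaklyReducible_genusThree_homotopySphere_gk` follows from its instance `hirr` for
balanced `(3; 1,1,1)`-trisections with fixed labels which are weakly reducible and NOT reducible
(Aranda–Zupan's five-chain case, Prop. 3.9, §6 pp. 20–24, Lemma 5.4, Prop. 5.5, `S_{±1} ≅ S⁴`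
p. 7).  Compared with
`az2025_weaklyReducible_genusThree_homotopySphere_gk_of_msz_of_splitting_of_irreducible`, the
non-separating splitting fact has been eliminated by the tree's theorem
`Trisection.not_simplyConnectedSpace_of_reducing_nonseparating`.
[cite: ArandaZupan2025, Thm. 1.3 (p. 2), §6 (pp. 20–24), Prop. 5.5] [cite: MeierSchirmerZupan2016, Thm. 1.2] -/
theorem az2025_weaklyReducible_genusThree_homotopySphere_gk_of_msz_of_separating_of_irreducible
    (hMSZ : msz_homotopySphere_gk.{u})
    (hsep : isConnectedSum_of_reducing_separating.{u})
    (hirr : ∀ (X : Type u) [TopologicalSpace X] [T2Space X] [SecondCountableTopology X]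
      [ChartedSpace (𝔼 4) X] [IsManifold (𝓡 4) ∞ X] [CompactSpace X] [ConnectedSpace X]
      (_ : SmoothOrientation (𝓡 4) X) (S : Fin 3 → Set X),
      IsBalancedGKTrisection X 3 1 S →
      (∃ c c' : Set X, IsCurve S c ∧ IsCurve S c' ∧ Disjoint c c' ∧
        IsNonSeparating S c ∧ IsNonSeparating S c' ∧
        BoundsDisc S (spineHandlebody S 0) c ∧ BoundsDisc S (spineHandlebody S 1) c' ∧
        BoundsDisc S (spineHandlebody S 2) c') →
      ¬ IsReducible S → X ≃ₕ 𝕊 4 → Nonempty (X ≃ₘ⟮𝓡 4, 𝓡 4⟯ (𝕊 4))) :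
    az2025_weaklyReducible_genusThree_homotopySphere_gk.{u} := by
  refine az2025_weaklyReducible_genusThree_homotopySphere_gk_of_msz_of_balanced hMSZ
    fun X _ _ _ _ _ _ _ o S hT hwr e => ?_
  by_cases hred : IsReducible S
  · exact nonempty_diffeomorph_sphere_of_isReducible_genusThree_of_separating hsep
      nonempty_homotopyEquiv_sphere_four_left_of_isConnectedSum_holds
      (mz_genus_le_two_homotopySphere_gk_of_msz_alone hMSZ) X o (fun _ => 1) S
      hT.isGKTrisection hred e
  · exact hirr X o S hT hwr hred e

end ReducibleBranch

end Literature.Barriers.SmoothPoincare4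

end
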